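import Summits.KontsevichZagierPeriods.KontsevichZagierPeriods.Theses.FurushoPentagon
import Summits.KontsevichZagierPeriods.KontsevichZagierPeriods.Theorems.FurushoPentagonReducedPeriodRingDefs
import Literature.NumberTheory.Transcendental.KZCubicalCalculus

/-!
# `ReducedPeriodRing`, line `effective-end-monoid`: soundness of the cubical Newton–Leibniz moves

Crux `FurushoPentagon.ReducedPeriodRing` (stmt-KontsevichZagierPeriods-3929), line
`effective-end-monoid`, stub **S2b** `stub_cubeNewtonLeibniz_sound`:
the cubical Newton–Leibniz family `cubeNewtonLeibnizRel` (Newton–Leibniz along the last coordinate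
of the closed unit cube `[0,1]ⁿ⁺¹ → [0,1]ⁿ`, with an analytic `ℚ`-semialgebraic primitive) consists
of relations of the Kontsevich–Zagier calculus (`KZ.relations`).

## Proof

The cube `[0,1]ⁿ⁺¹` is the band `{z | Fin.init z ∈ [0,1]ⁿ ∧ a (Fin.init z) ≤ z (Fin.last n) ≤
b (Fin.init z)}` of Kontsevich–Zagier's rule (3) (`KZ.newtonLeibnizRel`) for the constant bounds
`a = 0 ≤ b = 1` (rational constants, hence `ℚ`-semialgebraic on the base); continuity of
`t ↦ F (x, t)` on `[0,1]` follows from its differentiability there, and the derivative hypothesis on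
`(0,1)` from the one on `[0,1]`. This instance of rule (3) is already packaged in the tree as
`KZ.cubicalStokesGens ⊆ KZ.newtonLeibnizRel` (`KZCubicalCalculus.lean`), whose generator family
`KZ.cubicalStokesGens` is — by unfolding `unitCube n = {x | ∀ i, 0 ≤ x i ∧ x i ≤ 1} = KZ.cube n` —
definitionally the family `cubeNewtonLeibnizRel` of this line; we record that identification
(`rfl`) and also give the direct instance of `KZ.newtonLeibnizRel`, so that the statement does not
depend on the syntactic coincidence.

## References

* M. Kontsevich, D. Zagier, *Periods*, in: Mathematics Unlimited — 2001 and Beyond (2001), §1.2,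
  rule (3).
* J. Ayoub, *Periods and the conjectures of Grothendieck and Kontsevich–Zagier*, EMS Newsl. 91
  (2014), Def. 10 (Stokes generators `∂f/∂zᵢ − f|_{zᵢ=1} + f|_{zᵢ=0}`).
-/

noncomputable section

namespace Summit.KontsevichZagierPeriods.FurushoPentagon.ReducedPeriodRing

open Set
open Literature.NumberTheory.Transcendental Literature.NumberTheory.Transcendental.KZ

/-! ## S2b: the cubical Newton–Leibniz moves are KZ relations -/

/-- The cube `[0,1]ⁿ⁺¹` is the band over `[0,1]ⁿ` between the constant functions `0 ≤ 1` along the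
last coordinate — the shape of the domain of the Newton–Leibniz move `KZ.newtonLeibnizRel`.
[Kontsevich–Zagier 2001, §1.2 rule (3)] -/
private theorem cubeNL_unitCube_succ_eq (n : ℕ) :
    unitCube (n + 1) =
      {z | (Fin.init z : Fin n → ℝ) ∈ unitCube n ∧ 0 ≤ z (Fin.last n) ∧ z (Fin.last n) ≤ 1} := by
  ext z
  simp only [mem_unitCube, mem_setOf_eq, Fin.forall_fin_succ', Fin.init]

/-- **The cubical Newton–Leibniz family is an instance of Kontsevich–Zagier's rule (3).** For
`[r] − [r'] ∈ cubeNewtonLeibnizRel` with primitive `F`, the data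
`(n, r, r', a := 0, b := 1, F)` satisfy the clauses of `KZ.newtonLeibnizRel`: `F` is
`ℚ`-semialgebraic on `r.domain = [0,1]ⁿ⁺¹`; the constant bounds are `ℚ`-semialgebraic on
`r'.domain = [0,1]ⁿ` (polynomial functions `0`, `1`) with `0 ≤ 1`; the band of `0 ≤ t ≤ 1` over
`[0,1]ⁿ` is `[0,1]ⁿ⁺¹`; `t ↦ F (x, t)` is continuous on `[0,1]` (it is differentiable there) and has
derivative `r.integrand (x, t)` on `(0,1) ⊆ [0,1]`; and `r'.integrand x = F (x, 1) − F (x, 0)`.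
[Kontsevich–Zagier 2001, §1.2 rule (3); Ayoub 2014, Def. 10] -/
theorem cubeNL_subset_newtonLeibnizRel : cubeNewtonLeibnizRel ⊆ newtonLeibnizRel := by
  rintro c ⟨n, r, r', F, hr, -, hr', -, -, hF, hderiv, hr'F, rfl⟩
  have hsa : Literature.ModelTheory.ExponentialFields.IsSemialgebraic ℚ (unitCube n) :=
    hr' ▸ r'.isSemialgebraic_domain
  have h0 : IsSemialgebraicFunOn ℚ (unitCube n) (fun _ : Fin n → ℝ => (0 : ℝ)) := by
    simpa using isSemialgebraicFunOn_aeval (R := ℝ) hsa (0 : MvPolynomial (Fin n) ℚ)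
  have h1 : IsSemialgebraicFunOn ℚ (unitCube n) (fun _ : Fin n → ℝ => (1 : ℝ)) := by
    simpa using isSemialgebraicFunOn_aeval (R := ℝ) hsa (1 : MvPolynomial (Fin n) ℚ)
  refine ⟨n, r, r', fun _ => 0, fun _ => 1, F, ?_, ?_, ?_, ?_, ?_, ?_, ?_, ?_, rfl⟩
  · rw [hr]; exact hF
  · rw [hr']; exact h0
  · rw [hr']; exact h1
  · intro x _; exact zero_le_one
  · rw [hr, hr']; exact cubeNL_unitCube_succ_eq n
  · intro x hx
    rw [hr'] at hx
    exact HasDerivAt.continuousOn fun t ht => hderiv x hx t ht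
  · intro x hx t ht
    rw [hr'] at hx
    exact hderiv x hx t (Ioo_subset_Icc_self ht)
  · intro x hx
    rw [hr'] at hx
    exact hr'F x hx

/-- The cubical Newton–Leibniz family of this line is *literally* the Stokes generator family
`KZ.cubicalStokesGens` of the tree's cubical sub-calculus (`KZCubicalCalculus.lean`): both are the
same set-builder once `unitCube n` and `KZ.cube n` are unfolded to `{x | ∀ i, 0 ≤ x i ∧ x i ≤ 1}`.
[Ayoub 2014, Def. 10] -/
theorem cubeNL_eq_cubicalStokesGens : cubeNewtonLeibnizRel = cubicalStokesGens := rfl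

/-- **S2b (soundness of cubical Newton–Leibniz).** The cube `[0,1]ⁿ⁺¹` is the band `a = 0 ≤ b = 1`
over `[0,1]ⁿ`, so every cubical Newton–Leibniz move is a Newton–Leibniz move of the
Kontsevich–Zagier calculus, hence a relation. [Kontsevich–Zagier 2001, §1.2 rule (3)] -/
theorem stub_cubeNewtonLeibniz_sound : cubeNewtonLeibnizRel ⊆ (relations : Set FormalRep) :=
  cubeNL_subset_newtonLeibnizRel.trans newtonLeibnizRel_subset_relations

end Summit.KontsevichZagierPeriods.FurushoPentagon.ReducedPeriodRing
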